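import Literature.MathematicalPhysics.QuantumManyBody.JelliumOneBodyExpansion
import HarnessLib

/-!
# Weighted Pythagoras for the condensate projections: `∫ m(xᵢ)|F|² = ∫ m(xᵢ)|QⱼF|² + ∫ m(xᵢ)|PⱼF|²`

Topic `Literature/MathematicalPhysics/QuantumManyBody` (the charged Bose gas, `JelliumBoseGas.foldyLaw`).
Tool for [LiebSolovej2001, Lemma 5.3] in first quantization (the terms with `ŵ_{p0,q0}`: there
`∑_{j≠i}‖√m(xᵢ) PⱼQᵢΨ‖²` is rewritten through `Pⱼ + Qⱼ = 1`, `PⱼQⱼ = 0`): for a weight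
`m ≥ 0` depending on `xᵢ` only and `i ≠ j`, the projection `Pⱼ` in the OTHER variable is
orthogonal for the weighted norm as well,

`∫_{Λ^n} m(xᵢ)|F|² = ∫_{Λ^n} m(xᵢ)|QⱼF|² + ∫_{Λ^n} m(xᵢ)|PⱼF|²`   (`ℝ≥0∞`-valued, on `cellN`),

for bounded measurable `F` whose `Pⱼ` is bounded measurable (e.g. `F = QᵢΨ`, `Ψ` continuous):

* `lintegral_nnnorm_sq_cell_eq_of_bounded` — the variance identity on a fibre for bounded
  measurable functions (the continuous case is `lintegral_nnnorm_sq_cell_eq`);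
* `lintegral_cellN_weight_normSq_eq_add` — the weighted Pythagoras on `Λ^n`.

## References

* [LiebSolovej2001] E. H. Lieb, J. P. Solovej, Commun. Math. Phys. 217 (2001) 127–163, Lemma 5.3
  (proof) (arXiv:cond-mat/0007425, p. 11).
* [LSSY2005] Lieb–Seiringer–Solovej–Yngvason, *The Mathematics of the Bose Gas and its
  Condensation*, Ch. 5 (5.17) (the variance identity).
-/

noncomputable section

open MeasureTheory Set Filter Real
open scoped ENNReal NNReal Topology

namespace Literature.MathematicalPhysics.QuantumManyBody.JelliumBoseGas

open BoseGas
open Literature.Barriers.AtomisticToContinuum.BoseGas (inv_ofReal_pow_three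
  measurable_lintegral_cell_update)

variable {n : ℕ} {ℓ : ℝ}

/-! ### The variance identity for bounded measurable functions -/

/-- **The variance identity on the cell for bounded measurable `φ`**:
`∫_K |φ|² = ∫_K |φ - ⟨φ⟩_K|² + ℓ⁻³|∫_K φ|²`. [cite: LSSY2005, Ch. 5 (5.17)] -/
theorem lintegral_nnnorm_sq_cell_eq_of_bounded (hℓ : 0 < ℓ) {φ : Space → ℂ} (hφm : Measurable φ)
    {C : ℝ} (hC : ∀ x ∈ cell ℓ, ‖φ x‖ ≤ C) :
    ∫⁻ x in cell ℓ, (‖φ x‖₊ : ℝ≥0∞) ^ 2 =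
      (∫⁻ x in cell ℓ, (‖φ x - ⨍ y in cell ℓ, φ y‖₊ : ℝ≥0∞) ^ 2) +
        (ENNReal.ofReal ℓ ^ 3)⁻¹ * (‖∫ x in cell ℓ, φ x‖₊ : ℝ≥0∞) ^ 2 := by
  set c : ℂ := ⨍ y in cell ℓ, φ y with hc
  set I : ℂ := ∫ x in cell ℓ, φ x with hI
  have hL3 : 0 < ℓ ^ 3 := by positivity
  have hV : volume.real (cell ℓ) = ℓ ^ 3 := volume_real_cell hℓ.le
  have hcI : c = (ℓ ^ 3)⁻¹ • I := by rw [hc, setAverage_eq, hV]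
  haveI := isFiniteMeasure_restrict_cell ℓ
  have hC0 : ∀ x ∈ cell ℓ, (0 : ℝ) ≤ C := fun x hx => (norm_nonneg _).trans (hC x hx)
  -- integrability from boundedness
  have hint : IntegrableOn φ (cell ℓ) := by
    refine Integrable.mono' (integrable_const C) hφm.aestronglyMeasurable ?_
    exact (ae_restrict_iff' (measurableSet_cell ℓ)).2 (Eventually.of_forall hC)
  have hint2 : IntegrableOn (fun x => ‖φ x‖ ^ 2) (cell ℓ) := by
    refine Integrable.mono' (integrable_const (C ^ 2)) (hφm.norm.pow_const 2).aestronglyMeasurable ?_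
    refine (ae_restrict_iff' (measurableSet_cell ℓ)).2 (Eventually.of_forall fun x hx => ?_)
    rw [Real.norm_eq_abs, abs_of_nonneg (sq_nonneg _)]
    exact pow_le_pow_left₀ (norm_nonneg _) (hC x hx) 2
  have hint3 : IntegrableOn (fun x => ‖φ x - c‖ ^ 2) (cell ℓ) := by
    refine Integrable.mono' (integrable_const ((C + ‖c‖) ^ 2))
      ((hφm.sub_const c).norm.pow_const 2).aestronglyMeasurable ?_
    refine (ae_restrict_iff' (measurableSet_cell ℓ)).2 (Eventually.of_forall fun x hx => ?_)
    rw [Real.norm_eq_abs, abs_of_nonneg (sq_nonneg _)]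
    refine pow_le_pow_left₀ (norm_nonneg _) ((norm_sub_le _ _).trans ?_) 2
    linarith [hC x hx]
  have hinner : IntegrableOn (fun x => inner ℝ c (φ x)) (cell ℓ) := hint.const_inner c
  -- the real identity
  have key : ∫ x in cell ℓ, ‖φ x - c‖ ^ 2 = (∫ x in cell ℓ, ‖φ x‖ ^ 2) - (ℓ ^ 3)⁻¹ * ‖I‖ ^ 2 := by
    have h1 : (fun x => ‖φ x - c‖ ^ 2) = fun x => (‖φ x‖ ^ 2 - 2 * inner ℝ c (φ x)) + ‖c‖ ^ 2 := by
      funext x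
      rw [norm_sub_sq_real, real_inner_comm]
    have hA : Integrable (fun x => ‖φ x‖ ^ 2 - 2 * inner ℝ c (φ x)) (volume.restrict (cell ℓ)) :=
      hint2.sub' (hinner.const_mul 2)
    rw [h1, integral_add hA (integrable_const _),
      integral_sub hint2 (hinner.const_mul 2), integral_const_mul, setIntegral_const, hV,
      integral_inner hint c]
    change (∫ x in cell ℓ, ‖φ x‖ ^ 2) - 2 * inner ℝ c I + (ℓ ^ 3) • ‖c‖ ^ 2 =
      (∫ x in cell ℓ, ‖φ x‖ ^ 2) - (ℓ ^ 3)⁻¹ * ‖I‖ ^ 2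
    rw [hcI, real_inner_smul_left, real_inner_self_eq_norm_sq, norm_smul, Real.norm_eq_abs,
      abs_of_pos (inv_pos.2 hL3), smul_eq_mul]
    field_simp
    ring
  -- conversion to `ℝ≥0∞`
  have hnn1 : 0 ≤ ∫ x in cell ℓ, ‖φ x - c‖ ^ 2 := integral_nonneg fun _ => by positivity
  have hnn2 : 0 ≤ (ℓ ^ 3)⁻¹ * ‖I‖ ^ 2 := by positivity
  simp only [coe_nnnorm_sq_eq_ofReal]
  rw [← ofReal_integral_eq_lintegral_ofReal hint2 (ae_of_all _ fun _ => by positivity),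
    ← ofReal_integral_eq_lintegral_ofReal hint3 (ae_of_all _ fun _ => by positivity),
    inv_ofReal_pow_three hℓ, ← ENNReal.ofReal_mul (inv_pos.2 hL3).le,
    ← ENNReal.ofReal_add hnn1 hnn2, key, sub_add_cancel]

/-- **Pythagoras on a fibre for `F` with bounded measurable fibres**:
`∫_Λ |F(X;xⱼ↦y)|² dy = ∫_Λ |QⱼF|² dy + ℓ³ |PⱼF(X)|²`. [cite: LSSY2005, Ch. 5 (5.17)] -/
theorem lintegral_cell_normSq_eq_of_bounded (hℓ : 0 < ℓ) (j : Fin n) {F : Config n → ℂ}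
    (hFm : Measurable F) (X : Config n) {C : ℝ} (hC : ∀ y ∈ cell ℓ, ‖F (Function.update X j y)‖ ≤ C) :
    ∫⁻ y in cell ℓ, (‖F (Function.update X j y)‖₊ : ℝ≥0∞) ^ 2 =
      (∫⁻ y in cell ℓ, (‖sliceFluct ℓ j F (Function.update X j y)‖₊ : ℝ≥0∞) ^ 2) +
        ENNReal.ofReal ℓ ^ 3 * (‖sliceMean ℓ j F X‖₊ : ℝ≥0∞) ^ 2 := by
  have hm : Measurable fun y : Space => F (Function.update X j y) := hFm.comp (measurable_update _)
  rw [lintegral_nnnorm_sq_cell_eq_of_bounded hℓ hm hC]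
  simp_rw [sliceFluct_update]
  congr 1
  rw [sliceMean, setAverage_eq, volume_real_cell hℓ.le, ← ofReal_norm_sq_eq, ← ofReal_norm_sq_eq,
    inv_ofReal_pow_three hℓ, ← ENNReal.ofReal_pow hℓ.le, ← ENNReal.ofReal_mul (by positivity),
    ← ENNReal.ofReal_mul (by positivity)]
  congr 1
  rw [norm_smul, Real.norm_eq_abs, abs_of_pos (by positivity)]
  field_simp

/-! ### Weighted Pythagoras on `Λ^n` -/

/-- **Weighted Pythagoras** [LiebSolovej2001, Lemma 5.3 (proof)]: for `i ≠ j`, a measurable weight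
`m : ℝ³ → [0,∞]`, and a measurable `F` with bounded fibres in the `j`-th variable and bounded
measurable `PⱼF` (`ℓ > 0`),
`∫_{Λ^n} m(xᵢ)|F|² = ∫_{Λ^n} m(xᵢ)|QⱼF|² + ∫_{Λ^n} m(xᵢ)|PⱼF|²`. [cite: LiebSolovej2001, Lemma 5.3] -/
theorem lintegral_cellN_weight_normSq_eq_add (hℓ : 0 < ℓ) {i j : Fin n} (hij : i ≠ j)
    {m : Space → ℝ≥0∞} (hm : Measurable m) {F : Config n → ℂ} (hFm : Measurable F)
    (hPm : Measurable (sliceMean ℓ j F)) {C : ℝ}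
    (hC : ∀ X : Config n, ∀ y ∈ cell ℓ, ‖F (Function.update X j y)‖ ≤ C) :
    ∫⁻ X in cellN n ℓ, m (X i) * (‖F X‖₊ : ℝ≥0∞) ^ 2 =
      (∫⁻ X in cellN n ℓ, m (X i) * (‖sliceFluct ℓ j F X‖₊ : ℝ≥0∞) ^ 2) +
        ∫⁻ X in cellN n ℓ, m (X i) * (‖sliceMean ℓ j F X‖₊ : ℝ≥0∞) ^ 2 := by
  have hL3 : ENNReal.ofReal ℓ ^ 3 ≠ 0 := pow_ne_zero _ (by simpa using hℓ)
  have hL3' : ENNReal.ofReal ℓ ^ 3 ≠ ⊤ := ENNReal.pow_ne_top ENNReal.ofReal_ne_top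
  have hQm : Measurable (sliceFluct ℓ j F) := hFm.sub hPm
  -- measurability of the three integrands
  have hmi : Measurable fun X : Config n => m (X i) := hm.comp (measurable_pi_apply i)
  have hH : Measurable fun X : Config n => m (X i) * (‖F X‖₊ : ℝ≥0∞) ^ 2 :=
    hmi.mul (hFm.nnnorm.coe_nnreal_ennreal.pow_const _)
  have hHQ : Measurable fun X : Config n => m (X i) * (‖sliceFluct ℓ j F X‖₊ : ℝ≥0∞) ^ 2 :=
    hmi.mul (hQm.nnnorm.coe_nnreal_ennreal.pow_const _)
  have hHP : Measurable fun X : Config n => m (X i) * (‖sliceMean ℓ j F X‖₊ : ℝ≥0∞) ^ 2 :=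
    hmi.mul (hPm.nnnorm.coe_nnreal_ennreal.pow_const _)
  -- pass to the `j`-th fibres
  have e1 := lintegral_cellN_lintegral_update j hH (L := ℓ)
  have e2 := lintegral_cellN_lintegral_update j hHQ (L := ℓ)
  have e3 := lintegral_cellN_lintegral_update j hHP (L := ℓ)
  -- on each fibre the weight is constant and Pythagoras applies
  have hupd : ∀ (X : Config n) (y : Space), (Function.update X j y) i = X i := fun X y =>
    Function.update_of_ne hij _ _
  have hfib : ∀ X : Config n,
      ∫⁻ y in cell ℓ, m ((Function.update X j y) i) * (‖F (Function.update X j y)‖₊ : ℝ≥0∞) ^ 2 =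
        (∫⁻ y in cell ℓ, m ((Function.update X j y) i) *
            (‖sliceFluct ℓ j F (Function.update X j y)‖₊ : ℝ≥0∞) ^ 2) +
          ∫⁻ y in cell ℓ, m ((Function.update X j y) i) *
            (‖sliceMean ℓ j F (Function.update X j y)‖₊ : ℝ≥0∞) ^ 2 := by
    intro X
    simp_rw [hupd, sliceMean_update]
    have hmF : Measurable fun y : Space => (‖F (Function.update X j y)‖₊ : ℝ≥0∞) ^ 2 :=
      (hFm.comp (measurable_update _)).nnnorm.coe_nnreal_ennreal.pow_const _
    have hmQ : Measurable fun y : Space => (‖sliceFluct ℓ j F (Function.update X j y)‖₊ : ℝ≥0∞) ^ 2 :=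
      (hQm.comp (measurable_update _)).nnnorm.coe_nnreal_ennreal.pow_const _
    rw [lintegral_const_mul _ hmF, lintegral_const_mul _ hmQ, setLIntegral_const, volume_cell,
      lintegral_cell_normSq_eq_of_bounded hℓ j hFm X (hC X), mul_add]
    ring
  -- assemble: multiply by `ℓ³` and use the fibre identities
  have hmeasQ : Measurable fun X : Config n => ∫⁻ y in cell ℓ,
      m ((Function.update X j y) i) * (‖sliceFluct ℓ j F (Function.update X j y)‖₊ : ℝ≥0∞) ^ 2 :=
    measurable_lintegral_cell_update ℓ j hHQ
  rw [← ENNReal.mul_right_inj hL3 hL3', mul_add, ← e1, ← e2, ← e3, ← lintegral_add_left hmeasQ]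
  exact lintegral_congr fun X => hfib X

end Literature.MathematicalPhysics.QuantumManyBody.JelliumBoseGas
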